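/-
Copyright (c) 2026. All rights reserved.
Released under Apache 2.0 license as described in the file LICENSE.
Authors: abc-iut cell, wave-4 seat abc-iut-w4-d059 (proof-only; piece (P-A) of the (AI4″) producer: the
stabiliser of a compatible finite-level branch-pair system, in a compact group acting on the levels, is a
conjugate of the stabiliser of the reference pro-branch-pair; push to `Π_A`).
-/
import Literature.AnabelianGeometry.SemiGraphs.CompactOrbitLimit
import Literature.AnabelianGeometry.SemiGraphs.ArithMaximalCompact
import Literature.AnabelianGeometry.SemiGraphs.SemiGraph
import Mathlib.CategoryTheory.Endomorphism
import HarnessLib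

/-!
# [SemiAnbd] Thm 5.4 (i) p. 66 / Thm 3.7 (iii) p. 41: the stabiliser of a compatible finite-level
# branch-pair system in a compact group acting on the levels (proof-only)

Mochizuki, *Semi-graphs of anabelioids*, Publ. RIMS **42** (2006), proof of Thm 3.7 (iii) p. 41 with the
author's Comments (6)(b) ("converge, in the profinite topology … `H` is contained in … the intersection of the
images of `π₁(G_e)`, `π₁(G_{e'})` via `b`, `b'`", Remark 2.2.1) and Thm 5.4 (i) p. 66 ("entirely parallel",
arithmetic translation). [cite: MochizukiSemiAnbd2006, Thm 5.4 (i) p.66]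

PROOF-ONLY file (abc-iut cell, sub-DAG `plan/L3/SUBDAG-SemiAnbd-Thm54.md`, producer row T54-B, piece (P-A)
of the (AI4″) producer `stabBranchPairAug` of abc-iut-w4-d053's `ArithLevelDataCpt`, seat abc-iut-w4-d059).
A COMPACT group `Q` (a completion of `Π^temp_𝔊`) acts on the finite levels `G_j` (open kernels) over the
base graph `𝔾`, compatibly with the transition maps.  Reference data: for the base vertex `v` a compatible
level-vertex system `ω`, and for base branches `b`, `b'` at `v` compatible branch systems `κ`, `κ'` at `ω`.

* `stabilizer_branchPair_conj` — if (T1) at every level the (vertex, first-branch) data of the given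
  compatible system `(w; β, β')` over `(v; b, b')` is a `Q`-translate of `(ω, κ)`, and (T2) at every level
  every branch at `ω_j` over `b'` is a translate of `κ'_j` by an element of the CLOSED pro-vertex
  stabiliser `Stab_Q(ω)`, then for some `q ∈ Q` and some `δ ∈ Stab_Q(ω)` (with `b' ≠ b ∨ δ ∉ Stab_Q(ω, κ)`):
  every `g ∈ Q` fixing the given system satisfies
  `q⁻¹ g q ∈ Stab_Q(ω, κ) ∩ δ · Stab_Q(ω, κ') · δ⁻¹` — two applications of the orbit-closure lemma
  `CompactOrbit.exists_forall_apply_eq_of_forall_exists_mem`;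
* `map_aug_le_conj_of_stabilizer` — the push to `Π_A`: with `ιQ : E →* Q`, `augQ : Q →* Π_A`,
  `augQ ∘ ιQ = aug`, and the `Q`-dictionary of the reference data (`Stab_Q(ω) = ιQ(Π_v)`,
  `Stab_Q(ω, κ) = ιQ(Π_b)`, `Stab_Q(ω, κ') = ιQ(Π_{b'})`, `ιQ` injective on `Π_v`), every subgroup `C ≤ E`
  fixing the system has `aug(C) ≤ a · aug(Π_b ∩ h·Π_{b'}·h⁻¹) · a⁻¹` with `h ∈ Π_v`, `b' ≠ b ∨ h ∉ Π_b` —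
  the (AI4″) conclusion VERBATIM (for `D.vertGp v = Π_v`, `D.brGp b = Π_b`).

All inputs are binders (no definition, no named fact); the `Q`-package and the `Q`-dictionary of the
reference data are producer pieces (P-Q)/(P-A′).  Nothing here takes a side on [IUTchIII] Cor. 3.12. -/

namespace Literature.AnabelianGeometry.SemiGraphs

open CategoryTheory

universe v u w

section Orbit

variable {Q : Type u} [Group Q] [TopologicalSpace Q] [IsTopologicalGroup Q] [CompactSpace Q]
  {J : Type v} [Preorder J] [IsDirectedOrder J]
  (G : J → SemiGraph.{w}) (τ : ∀ j, Q →* Aut (G j)) (gf : ∀ ⦃i j : J⦄, i ≤ j → (G j ⟶ G i))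

omit [TopologicalSpace Q] [IsTopologicalGroup Q] [CompactSpace Q] [IsDirectedOrder J] in
/-- Pointwise equivariance on vertices from the morphism-level statement. [folklore] -/
private theorem eqV (hgfe : ∀ ⦃i j : J⦄ (h : i ≤ j) (q : Q), (τ j q).hom ≫ gf h = gf h ≫ (τ i q).hom)
    ⦃i j : J⦄ (h : i ≤ j) (q : Q) (x : (G j).Vertex) :
    (gf h).vertexMap ((τ j q).hom.vertexMap x) = (τ i q).hom.vertexMap ((gf h).vertexMap x) := by
  have := congrArg (fun ψ : G j ⟶ G i => ψ.vertexMap x) (hgfe h q)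
  simpa using this

omit [TopologicalSpace Q] [IsTopologicalGroup Q] [CompactSpace Q] [IsDirectedOrder J] in
/-- Pointwise equivariance on branches from the morphism-level statement. [folklore] -/
private theorem eqB (hgfe : ∀ ⦃i j : J⦄ (h : i ≤ j) (q : Q), (τ j q).hom ≫ gf h = gf h ≫ (τ i q).hom)
    ⦃i j : J⦄ (h : i ≤ j) (q : Q) (x : (G j).Branch) :
    (gf h).branchMap ((τ j q).hom.branchMap x) = (τ i q).hom.branchMap ((gf h).branchMap x) := by
  have := congrArg (fun ψ : G j ⟶ G i => ψ.branchMap x) (hgfe h q)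
  simpa using this
omit [TopologicalSpace Q] [IsTopologicalGroup Q] [CompactSpace Q] [Preorder J] [IsDirectedOrder J] in
/-- Products act by composition (vertices). [folklore] -/
private theorem mulV (j : J) (a b : Q) (x : (G j).Vertex) :
    (τ j (a * b)).hom.vertexMap x = (τ j a).hom.vertexMap ((τ j b).hom.vertexMap x) := by
  rw [map_mul]; rfl
omit [TopologicalSpace Q] [IsTopologicalGroup Q] [CompactSpace Q] [Preorder J] [IsDirectedOrder J] in
/-- The action of a product on branches. [folklore] -/
private theorem mulB (j : J) (a b : Q) (x : (G j).Branch) :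
    (τ j (a * b)).hom.branchMap x = (τ j a).hom.branchMap ((τ j b).hom.branchMap x) := by
  rw [map_mul]; rfl
omit [TopologicalSpace Q] [IsTopologicalGroup Q] [CompactSpace Q] [Preorder J] [IsDirectedOrder J] in
/-- `a⁻¹` undoes `a` on vertices. [folklore] -/
private theorem invV (j : J) (a : Q) (x : (G j).Vertex) :
    (τ j a⁻¹).hom.vertexMap ((τ j a).hom.vertexMap x) = x := by
  rw [← mulV, inv_mul_cancel, map_one]; rfl
omit [TopologicalSpace Q] [IsTopologicalGroup Q] [CompactSpace Q] [Preorder J] [IsDirectedOrder J] in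
/-- `a⁻¹` undoes `a` on branches. [folklore] -/
private theorem invB (j : J) (a : Q) (x : (G j).Branch) :
    (τ j a⁻¹).hom.branchMap ((τ j a).hom.branchMap x) = x := by
  rw [← mulB, inv_mul_cancel, map_one]; rfl

omit [IsTopologicalGroup Q] [CompactSpace Q] [Preorder J] [IsDirectedOrder J] in
/-- Vertex transporters are closed (open kernels). [cite: MochizukiSemiAnbd2006, Thm 3.7(iii) p.41] -/
private theorem isClosed_vertex_transporter [ContinuousMul Q] (hker : ∀ j, IsOpen ((τ j).ker : Set Q))
    (j : J) (x y : (G j).Vertex) : IsClosed {q : Q | (τ j q).hom.vertexMap x = y} := by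
  let φ : Q →* Function.End (G j).Vertex :=
    { toFun := fun q => fun z : (G j).Vertex => (τ j q).hom.vertexMap z
      map_one' := by funext z; show (τ j 1).hom.vertexMap z = z; rw [map_one]; rfl
      map_mul' := fun a b => by
        funext z; show (τ j (a * b)).hom.vertexMap z = _; rw [map_mul]; rfl }
  have hk : IsOpen (φ.ker : Set Q) := by
    refine Subgroup.isOpen_mono (H₁ := (τ j).ker) ?_ (hker j)
    intro q hq
    rw [MonoidHom.mem_ker] at hq ⊢
    funext z
    show (τ j q).hom.vertexMap z = z
    rw [hq]; rfl
  exact CompactOrbit.isClosed_setOf_apply_eq (J := PUnit.{1}) (X := fun _ => (G j).Vertex) (fun _ => φ)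
    (fun _ => hk) PUnit.unit x y

/-- **The stabiliser of a compatible finite-level branch-pair system is a conjugate of the stabiliser of the
reference pro-branch-pair** (Comments (6)(b) "converge, in the profinite topology", in the arithmetic
setting of Thm 5.4 (i)): reference data = a compatible level-vertex system `ω` over the base vertex `v₀`
and, for every base branch `b₀` at `v₀`, a compatible branch system `κs b₀` at `ω` over `b₀`; (T1) at
every level every (vertex, branch) over `(v₀, b₀)` is a `Q`-translate of `(ω_j, κs b₀ j)`; (T2) at every
level every branch at `ω_j` over `b₀` is a translate of `κs b₀ j` by an element fixing the whole system
`ω`.  Conclusion: for the given system `(w; β ≠ β')` from level `j₀` on, lying over `v₀`, there are base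
branches `b`, `b''` at `v₀`, `q ∈ Q` and `δ ∈ Stab_Q(ω)` with `b'' ≠ b ∨ δ ∉ Stab_Q(ω, κs b)` such that every
`g` fixing the system satisfies `q⁻¹ g q ∈ Stab_Q(ω, κs b)` and `δ⁻¹ (q⁻¹ g q) δ ∈ Stab_Q(ω, κs b'')`.
[cite: MochizukiSemiAnbd2006, Thm 5.4 (i) p.66] -/
theorem stabilizer_branchPair_conj (hker : ∀ j, IsOpen ((τ j).ker : Set Q))
    (hgfe : ∀ ⦃i j : J⦄ (h : i ≤ j) (q : Q), (τ j q).hom ≫ gf h = gf h ≫ (τ i q).hom)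
    {Base : SemiGraph.{w}} (proj : ∀ j, G j ⟶ Base)
    (hprojTrans : ∀ ⦃i j : J⦄ (h : i ≤ j), gf h ≫ proj i = proj j)
    (v₀ : Base.Vertex) (ω : ∀ j, (G j).Vertex) (hωv : ∀ j, (proj j).vertexMap (ω j) = v₀)
    (hω : ∀ ⦃i j : J⦄ (h : i ≤ j), (gf h).vertexMap (ω j) = ω i)
    (κs : Base.Branch → ∀ j, (G j).Branch)
    (hκs : ∀ (b₀ : Base.Branch), Base.abuts b₀ = some v₀ →
      (∀ j, (G j).abuts (κs b₀ j) = some (ω j) ∧ (proj j).branchMap (κs b₀ j) = b₀) ∧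
        ∀ ⦃i j : J⦄ (h : i ≤ j), (gf h).branchMap (κs b₀ j) = κs b₀ i)
    (htrans₁ : ∀ (j : J) (x : (G j).Vertex) (γ : (G j).Branch) (b₀ : Base.Branch),
      (proj j).vertexMap x = v₀ → (G j).abuts γ = some x → (proj j).branchMap γ = b₀ →
      ∃ q : Q, (τ j q).hom.vertexMap (ω j) = x ∧ (τ j q).hom.branchMap (κs b₀ j) = γ)
    (htrans₂ : ∀ (j : J) (γ : (G j).Branch) (b₀ : Base.Branch),
      (G j).abuts γ = some (ω j) → (proj j).branchMap γ = b₀ →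
      ∃ a : Q, (∀ i, (τ i a).hom.vertexMap (ω i) = ω i) ∧ (τ j a).hom.branchMap (κs b₀ j) = γ)
    (j₀ : J) (w : ∀ i : {i : J // j₀ ≤ i}, (G i.1).Vertex) (β β' : ∀ i : {i : J // j₀ ≤ i}, (G i.1).Branch)
    (hpair : ∀ i, β i ≠ β' i ∧ (G i.1).abuts (β i) = some (w i) ∧ (G i.1).abuts (β' i) = some (w i))
    (hcompat : ∀ ⦃i i' : {i : J // j₀ ≤ i}⦄ (h : i.1 ≤ i'.1), (gf h).vertexMap (w i') = w i ∧
      (gf h).branchMap (β i') = β i ∧ (gf h).branchMap (β' i') = β' i)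
    (hbase : ∀ i : {i : J // j₀ ≤ i}, (proj i.1).vertexMap (w i) = v₀) :
    ∃ (b b'' : Base.Branch) (q δ : Q), Base.abuts b = some v₀ ∧ Base.abuts b'' = some v₀ ∧
      (∀ j, (τ j δ).hom.vertexMap (ω j) = ω j) ∧
      (b'' ≠ b ∨ ¬ ∀ j, (τ j δ).hom.branchMap (κs b j) = κs b j) ∧
      ∀ g : Q, (∀ i : {i : J // j₀ ≤ i}, (τ i.1 g).hom.vertexMap (w i) = w i ∧
          (τ i.1 g).hom.branchMap (β i) = β i ∧ (τ i.1 g).hom.branchMap (β' i) = β' i) →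
        (∀ j, (τ j (q⁻¹ * g * q)).hom.vertexMap (ω j) = ω j ∧
          (τ j (q⁻¹ * g * q)).hom.branchMap (κs b j) = κs b j) ∧
        ∀ j, (τ j (δ⁻¹ * (q⁻¹ * g * q) * δ)).hom.vertexMap (ω j) = ω j ∧
          (τ j (δ⁻¹ * (q⁻¹ * g * q) * δ)).hom.branchMap (κs b'' j) = κs b'' j := by
  classical
  -- the index set of the given system is directed and nonempty
  haveI : IsDirectedOrder {i : J // j₀ ≤ i} := by
    refine ⟨fun a c => ?_⟩
    obtain ⟨d, had, hcd⟩ := exists_ge_ge a.1 c.1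
    exact ⟨⟨d, a.2.trans had⟩, had, hcd⟩
  haveI : Nonempty {i : J // j₀ ≤ i} := ⟨⟨j₀, le_rfl⟩⟩
  have eqV' := eqV G τ gf hgfe; have eqB' := eqB G τ gf hgfe
  -- base projections are constant along compatible systems
  have projB : ∀ ⦃i j : J⦄ (h : i ≤ j) (x : (G j).Branch), (proj i).branchMap ((gf h).branchMap x) =
      (proj j).branchMap x := fun i j h x => by
    have := congrArg (fun ψ : G j ⟶ Base => ψ.branchMap x) (hprojTrans h)
    simpa using this
  -- the base branches `b`, `b'` of the given system
  set i₀ : {i : J // j₀ ≤ i} := ⟨j₀, le_rfl⟩ with hi₀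
  set b : Base.Branch := (proj j₀).branchMap (β i₀) with hb_def
  have hb : ∀ i : {i : J // j₀ ≤ i}, (proj i.1).branchMap (β i) = b := by
    intro i
    obtain ⟨k, hik, h0k⟩ := exists_ge_ge i i₀
    rw [hb_def, ← (hcompat (i := i) (i' := k) hik).2.1, projB,
      ← (hcompat (i := i₀) (i' := k) h0k).2.1, projB]
  have hbv : Base.abuts b = some v₀ := by
    have := (proj j₀).abuts_branchMap (β i₀) (w i₀) (hpair i₀).2.1
    rw [hbase i₀] at this; exact this
  obtain ⟨⟨hκb, hκbc⟩⟩ := (⟨hκs b hbv⟩ : PLift _)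
  -- Step 1: `(w, β) = q · (ω, κs b)` for one `q`
  let φ₁ : ∀ i : {i : J // j₀ ≤ i}, Q →* Function.End ((G i.1).Vertex × (G i.1).Branch) := fun i =>
    { toFun := fun q => fun p : (G i.1).Vertex × (G i.1).Branch =>
        ((τ i.1 q).hom.vertexMap p.1, (τ i.1 q).hom.branchMap p.2)
      map_one' := by
        funext p; show ((τ i.1 1).hom.vertexMap p.1, (τ i.1 1).hom.branchMap p.2) = p; rw [map_one]; rfl
      map_mul' := fun a c => by
        funext p
        show ((τ i.1 (a * c)).hom.vertexMap p.1, (τ i.1 (a * c)).hom.branchMap p.2) = _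
        rw [map_mul]; rfl }
  have hφ₁ : ∀ (i : {i : J // j₀ ≤ i}) (q : Q) (p : (G i.1).Vertex × (G i.1).Branch),
      φ₁ i q p = ((τ i.1 q).hom.vertexMap p.1, (τ i.1 q).hom.branchMap p.2) := fun _ _ _ => rfl
  have hker₁ : ∀ i : {i : J // j₀ ≤ i}, IsOpen ((φ₁ i).ker : Set Q) := by
    intro i
    refine Subgroup.isOpen_mono (H₁ := (τ i.1).ker) ?_ (hker i.1)
    intro q hq
    rw [MonoidHom.mem_ker] at hq ⊢
    funext p
    show ((τ i.1 q).hom.vertexMap p.1, (τ i.1 q).hom.branchMap p.2) = p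
    rw [hq]; rfl
  obtain ⟨q, hq⟩ := CompactOrbit.exists_forall_apply_eq_of_forall_exists (φ := φ₁)
    (t := fun i i' h p => ((gf (show i.1 ≤ i'.1 from h)).vertexMap p.1, (gf (show i.1 ≤ i'.1 from h)).branchMap p.2))
    hker₁
    (fun i i' h q p => by
      simp only [hφ₁]
      exact Prod.ext (eqV' h q p.1) (eqB' h q p.2))
    (s := fun i => (ω i.1, κs b i.1)) (s' := fun i => (w i, β i))
    (fun i i' h => Prod.ext (hω h) (hκbc h))
    (fun i i' h => Prod.ext (hcompat h).1 (hcompat h).2.1)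
    (fun i => by
      obtain ⟨q, hq1, hq2⟩ := htrans₁ i.1 (w i) (β i) b (hbase i) (hpair i).2.1 (hb i)
      exact ⟨q, Prod.ext hq1 hq2⟩)
  have hqω : ∀ i : {i : J // j₀ ≤ i}, (τ i.1 q).hom.vertexMap (ω i.1) = w i :=
    fun i => congrArg Prod.fst (hq i)
  have hqκ : ∀ i : {i : J // j₀ ≤ i}, (τ i.1 q).hom.branchMap (κs b i.1) = β i :=
    fun i => congrArg Prod.snd (hq i)
  -- Step 2: the second branch of the translated system, `γ = q⁻¹ · β'`, a branch at `ω` over `b''`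
  let γ : ∀ i : {i : J // j₀ ≤ i}, (G i.1).Branch := fun i => (τ i.1 q⁻¹).hom.branchMap (β' i)
  have hγω : ∀ i, (G i.1).abuts (γ i) = some (ω i.1) := by
    intro i
    have := (τ i.1 q⁻¹).hom.abuts_branchMap (β' i) (w i) (hpair i).2.2
    rw [← hqω i, invV] at this
    exact this
  have hγc : ∀ ⦃i i' : {i : J // j₀ ≤ i}⦄ (h : i.1 ≤ i'.1), (gf h).branchMap (γ i') = γ i := by
    intro i i' h
    change (gf h).branchMap ((τ i'.1 q⁻¹).hom.branchMap (β' i')) = (τ i.1 q⁻¹).hom.branchMap (β' i)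
    rw [eqB' h, (hcompat h).2.2]
  set b'' : Base.Branch := (proj j₀).branchMap (γ i₀) with hb''_def
  have hb'' : ∀ i : {i : J // j₀ ≤ i}, (proj i.1).branchMap (γ i) = b'' := by
    intro i
    obtain ⟨k, hik, h0k⟩ := exists_ge_ge i i₀
    rw [hb''_def, ← hγc (i := i) (i' := k) hik, projB, ← hγc (i := i₀) (i' := k) h0k, projB]
  have hb''v : Base.abuts b'' = some v₀ := by
    have := (proj j₀).abuts_branchMap (γ i₀) (ω j₀) (hγω i₀)
    rw [hωv j₀] at this; exact this
  obtain ⟨⟨hκb'', hκb''c⟩⟩ := (⟨hκs b'' hb''v⟩ : PLift _)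
  -- the closed pro-vertex stabiliser `A = Stab_Q(ω)`
  let A : Subgroup Q :=
    { carrier := {a | ∀ j, (τ j a).hom.vertexMap (ω j) = ω j}
      mul_mem' := fun {a c} ha hc j => by
        rw [mulV, hc j, ha j]
      one_mem' := fun j => by
        change (τ j 1).hom.vertexMap (ω j) = ω j
        rw [map_one]; rfl
      inv_mem' := fun {a} ha j => by
        conv_lhs => rw [← ha j]
        rw [invV] }
  have hAmem : ∀ a : Q, a ∈ A ↔ ∀ j, (τ j a).hom.vertexMap (ω j) = ω j := fun a => Iff.rfl
  have hAclosed : IsClosed (A : Set Q) := by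
    have : (A : Set Q) = ⋂ j, {a : Q | (τ j a).hom.vertexMap (ω j) = ω j} := by
      ext a; simp [hAmem]
    rw [this]
    exact isClosed_iInter fun j => isClosed_vertex_transporter G τ hker j _ _
  -- `γ = δ · κs b''` on the system levels, for one `δ ∈ A`
  let φ₂ : ∀ i : {i : J // j₀ ≤ i}, Q →* Function.End (G i.1).Branch := fun i =>
    { toFun := fun q => fun x : (G i.1).Branch => (τ i.1 q).hom.branchMap x
      map_one' := by funext x; show (τ i.1 1).hom.branchMap x = x; rw [map_one]; rfl
      map_mul' := fun a c => by
        funext x; show (τ i.1 (a * c)).hom.branchMap x = _; rw [map_mul]; rfl }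
  have hφ₂ : ∀ (i : {i : J // j₀ ≤ i}) (q : Q) (x : (G i.1).Branch),
      φ₂ i q x = (τ i.1 q).hom.branchMap x := fun _ _ _ => rfl
  have hker₂ : ∀ i : {i : J // j₀ ≤ i}, IsOpen ((φ₂ i).ker : Set Q) := by
    intro i
    refine Subgroup.isOpen_mono (H₁ := (τ i.1).ker) ?_ (hker i.1)
    intro q hq
    rw [MonoidHom.mem_ker] at hq ⊢
    funext x
    show (τ i.1 q).hom.branchMap x = x
    rw [hq]; rfl
  obtain ⟨δ, hδA, hδ⟩ := CompactOrbit.exists_forall_apply_eq_of_forall_exists_mem (φ := φ₂)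
    (t := fun i i' h x => (gf (show i.1 ≤ i'.1 from h)).branchMap x)
    hker₂ (fun i i' h q x => by simp only [hφ₂]; exact eqB' h q x) A hAclosed
    (s := fun i => κs b'' i.1) (s' := γ)
    (fun i i' h => hκb''c h) hγc
    (fun i => by
      obtain ⟨a, ha, ha'⟩ := htrans₂ i.1 (γ i) b'' (hγω i) (hb'' i)
      exact ⟨a, (hAmem a).mpr ha, ha'⟩)
  have hδω : ∀ j, (τ j δ).hom.vertexMap (ω j) = ω j := (hAmem δ).mp hδA
  have hδκ : ∀ i : {i : J // j₀ ≤ i}, (τ i.1 δ).hom.branchMap (κs b'' i.1) = γ i := hδ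
  refine ⟨b, b'', q, δ, hbv, hb''v, hδω, ?_, fun g hg => ?_⟩
  · -- side condition: if `b'' = b` then `δ` moves `κs b` (the two branches of the pair differ)
    by_cases hbb : b'' = b
    · refine Or.inr fun hfix => (hpair i₀).1 ?_
      have h1 : (τ j₀ δ).hom.branchMap (κs b j₀) = γ i₀ := by rw [← hbb]; exact hδκ i₀
      rw [hfix j₀] at h1
      -- `κs b j₀ = q⁻¹ β i₀` and `γ i₀ = q⁻¹ β' i₀`
      have h2 : κs b j₀ = (τ j₀ q⁻¹).hom.branchMap (β i₀) := by rw [← hqκ i₀, invB]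
      have h3 : (τ j₀ q⁻¹).hom.branchMap (β i₀) = (τ j₀ q⁻¹).hom.branchMap (β' i₀) := by
        rw [← h2, h1]
      have := congrArg ((τ j₀ q).hom.branchMap) h3
      rwa [← mulB, ← mulB, mul_inv_cancel, map_one] at this
    · exact Or.inl hbb
  · -- `g' := q⁻¹ g q` fixes `(ω, κs b)` and `γ` on the system levels
    have hg'ω : ∀ i : {i : J // j₀ ≤ i}, (τ i.1 (q⁻¹ * g * q)).hom.vertexMap (ω i.1) = ω i.1 := by
      intro i
      rw [mulV, mulV, hqω i, (hg i).1, ← hqω i, invV]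
    have hg'κ : ∀ i : {i : J // j₀ ≤ i}, (τ i.1 (q⁻¹ * g * q)).hom.branchMap (κs b i.1) = κs b i.1 := by
      intro i
      rw [mulB, mulB, hqκ i, (hg i).2.1, ← hqκ i, invB]
    have hg'γ : ∀ i : {i : J // j₀ ≤ i}, (τ i.1 (q⁻¹ * g * q)).hom.branchMap (γ i) = γ i := by
      intro i
      change (τ i.1 (q⁻¹ * g * q)).hom.branchMap ((τ i.1 q⁻¹).hom.branchMap (β' i)) =
        (τ i.1 q⁻¹).hom.branchMap (β' i)
      rw [← mulB, show q⁻¹ * g * q * q⁻¹ = q⁻¹ * g by group, mulB, (hg i).2.2]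
    -- extension from the system levels to all levels along the directed order
    have ext : ∀ (a : Q) (x : ∀ j, (G j).Branch), (∀ ⦃i j : J⦄ (h : i ≤ j), (gf h).branchMap (x j) = x i) →
        (∀ i : {i : J // j₀ ≤ i}, (τ i.1 a).hom.branchMap (x i.1) = x i.1) →
        ∀ j, (τ j a).hom.branchMap (x j) = x j := by
      intro a x hx hfix j
      obtain ⟨k, hjk, h0k⟩ := exists_ge_ge j j₀
      rw [← hx hjk, ← eqB' hjk a (x k), hfix ⟨k, h0k⟩]
    have extV : ∀ a : Q, (∀ i : {i : J // j₀ ≤ i}, (τ i.1 a).hom.vertexMap (ω i.1) = ω i.1) →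
        ∀ j, (τ j a).hom.vertexMap (ω j) = ω j := by
      intro a hfix j
      obtain ⟨k, hjk, h0k⟩ := exists_ge_ge j j₀
      rw [← hω hjk, ← eqV' hjk a (ω k), hfix ⟨k, h0k⟩]
    have hg'ω' : ∀ j, (τ j (q⁻¹ * g * q)).hom.vertexMap (ω j) = ω j := extV _ hg'ω
    refine ⟨fun j => ⟨hg'ω' j, ext _ (κs b) hκbc hg'κ j⟩, fun j => ⟨?_, ?_⟩⟩
    · -- `δ⁻¹ g' δ` fixes `ω`
      rw [mulV, mulV, hδω j, hg'ω' j, ← hδω j, invV, hδω j]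
    · -- `δ⁻¹ g' δ` fixes `κs b''`: on the system levels through `γ = δ · κs b''`, then everywhere
      refine ext _ (κs b'') hκb''c (fun i => ?_) j
      rw [mulB, mulB, hδκ i, hg'γ i, ← hδκ i, invB]

/-- **The (AI4″) conclusion, from the compact completion** (push to `Π_A`): under the hypotheses of
`stabilizer_branchPair_conj`, given `ιQ : E →* Q` and `augQ : Q →* Π_A` with `augQ ∘ ιQ = aug`, the
`Q`-DICTIONARY of the reference data — `Stab_Q(ω) = ιQ(Π_{v₀})`, `Stab_Q(ω, κs b₀) = ιQ(Π_{b₀})` for the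
decomposition groups of `D` — and `ιQ` injective on `Π_{v₀}`: every subgroup `C ≤ E` whose image fixes the
given branch-pair system satisfies `aug(C) ≤ a · aug(Π_b ∩ h·Π_{b'}·h⁻¹) · a⁻¹` for base branches `b`, `b'`
at `v₀`, some `h ∈ Π_{v₀}` with `b' ≠ b ∨ h ∉ Π_b`, and some `a ∈ Π_A` — the field `stabBranchPairAug` of
abc-iut-w4-d053's `ArithLevelDataCpt`, modulo the `Q`-package and the `Q`-dictionary (producer pieces
(P-Q)/(P-A′)). [cite: MochizukiSemiAnbd2006, Thm 5.4 (i) p.66] -/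
theorem map_aug_le_conj_of_stabilizer (hker : ∀ j, IsOpen ((τ j).ker : Set Q))
    (hgfe : ∀ ⦃i j : J⦄ (h : i ≤ j) (q : Q), (τ j q).hom ≫ gf h = gf h ≫ (τ i q).hom)
    {Base : SemiGraph.{w}} (proj : ∀ j, G j ⟶ Base)
    (hprojTrans : ∀ ⦃i j : J⦄ (h : i ≤ j), gf h ≫ proj i = proj j)
    (v₀ : Base.Vertex) (ω : ∀ j, (G j).Vertex) (hωv : ∀ j, (proj j).vertexMap (ω j) = v₀)
    (hω : ∀ ⦃i j : J⦄ (h : i ≤ j), (gf h).vertexMap (ω j) = ω i)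
    (κs : Base.Branch → ∀ j, (G j).Branch)
    (hκs : ∀ (b₀ : Base.Branch), Base.abuts b₀ = some v₀ →
      (∀ j, (G j).abuts (κs b₀ j) = some (ω j) ∧ (proj j).branchMap (κs b₀ j) = b₀) ∧
        ∀ ⦃i j : J⦄ (h : i ≤ j), (gf h).branchMap (κs b₀ j) = κs b₀ i)
    (htrans₁ : ∀ (j : J) (x : (G j).Vertex) (γ : (G j).Branch) (b₀ : Base.Branch),
      (proj j).vertexMap x = v₀ → (G j).abuts γ = some x → (proj j).branchMap γ = b₀ →
      ∃ q : Q, (τ j q).hom.vertexMap (ω j) = x ∧ (τ j q).hom.branchMap (κs b₀ j) = γ)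
    (htrans₂ : ∀ (j : J) (γ : (G j).Branch) (b₀ : Base.Branch),
      (G j).abuts γ = some (ω j) → (proj j).branchMap γ = b₀ →
      ∃ a : Q, (∀ i, (τ i a).hom.vertexMap (ω i) = ω i) ∧ (τ j a).hom.branchMap (κs b₀ j) = γ)
    (j₀ : J) (w : ∀ i : {i : J // j₀ ≤ i}, (G i.1).Vertex) (β β' : ∀ i : {i : J // j₀ ≤ i}, (G i.1).Branch)
    (hpair : ∀ i, β i ≠ β' i ∧ (G i.1).abuts (β i) = some (w i) ∧ (G i.1).abuts (β' i) = some (w i))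
    (hcompat : ∀ ⦃i i' : {i : J // j₀ ≤ i}⦄ (h : i.1 ≤ i'.1), (gf h).vertexMap (w i') = w i ∧
      (gf h).branchMap (β i') = β i ∧ (gf h).branchMap (β' i') = β' i)
    (hbase : ∀ i : {i : J // j₀ ≤ i}, (proj i.1).vertexMap (w i) = v₀)
    {E : Type*} [Group E] (ιQ : E →* Q) {PA : Type*} [Group PA] (aug : E →* PA) (augQ : Q →* PA)
    (haug : ∀ e : E, augQ (ιQ e) = aug e)
    (D : DecompositionData E Base.Vertex Base.Branch) (hDabut : ∀ b₀, D.abut b₀ = Base.abuts b₀)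
    (hω_dict : ∀ q : Q, (∀ j, (τ j q).hom.vertexMap (ω j) = ω j) ↔ q ∈ (D.vertGp v₀).map ιQ)
    (hκ_dict : ∀ b₀ : Base.Branch, Base.abuts b₀ = some v₀ → ∀ q : Q,
      (∀ j, (τ j q).hom.vertexMap (ω j) = ω j ∧ (τ j q).hom.branchMap (κs b₀ j) = κs b₀ j) ↔
        q ∈ (D.brGp b₀).map ιQ)
    (hinj : Set.InjOn ιQ (D.vertGp v₀))
    (C : Subgroup E)
    (hC : ∀ (i : {i : J // j₀ ≤ i}) (e : E), e ∈ C → (τ i.1 (ιQ e)).hom.vertexMap (w i) = w i ∧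
      (τ i.1 (ιQ e)).hom.branchMap (β i) = β i ∧ (τ i.1 (ιQ e)).hom.branchMap (β' i) = β' i) :
    ∃ (v : Base.Vertex) (b b' : Base.Branch) (a : PA) (h : E), D.abut b = some v ∧ D.abut b' = some v ∧
      h ∈ D.vertGp v ∧ (b' ≠ b ∨ h ∉ D.brGp b) ∧
      C.map aug ≤ conjSubgroup a ((D.brGp b ⊓ conjSubgroup h (D.brGp b')).map aug) := by
  obtain ⟨b, b'', q, δ, hbv, hb''v, hδω, hside, hstab⟩ := stabilizer_branchPair_conj G τ gf hker hgfe proj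
    hprojTrans v₀ ω hωv hω κs hκs htrans₁ htrans₂ j₀ w β β' hpair hcompat hbase
  -- `δ = ιQ h` with `h ∈ Π_{v₀}`
  obtain ⟨h, hh, hhδ⟩ := (hω_dict δ).mp hδω
  have hbD : D.abut b = some v₀ := by rw [hDabut]; exact hbv
  have hb''D : D.abut b'' = some v₀ := by rw [hDabut]; exact hb''v
  refine ⟨v₀, b, b'', augQ q, h, hbD, hb''D, hh, ?_, ?_⟩
  · -- side condition
    rcases hside with hne | hmove
    · exact Or.inl hne
    · refine Or.inr fun hhb => hmove fun j => ?_
      have : δ ∈ (D.brGp b).map ιQ := ⟨h, hhb, hhδ⟩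
      exact (((hκ_dict b hbv δ).mpr this) j).2
  · -- the containment
    rintro _ ⟨e, he, rfl⟩
    obtain ⟨h₁, h₂⟩ := hstab (ιQ e) (fun i => hC i e he)
    obtain ⟨k₁, hk₁, hk₁e⟩ := (hκ_dict b hbv _).mp h₁
    obtain ⟨k₂, hk₂, hk₂e⟩ := (hκ_dict b'' hb''v _).mp h₂
    -- `ιQ k₁ = δ ιQ(k₂) δ⁻¹ = ιQ (h k₂ h⁻¹)`, and `ιQ` is injective on `Π_{v₀}`
    have hk₁' : k₁ = h * k₂ * h⁻¹ := by
      apply hinj (D.brGp_le_vertGp b v₀ hbD hk₁)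
        ((D.vertGp v₀).mul_mem ((D.vertGp v₀).mul_mem hh (D.brGp_le_vertGp b'' v₀ hb''D hk₂))
          ((D.vertGp v₀).inv_mem hh))
      rw [map_mul, map_mul, map_inv, hhδ, hk₂e, hk₁e]
      group
    have hk₁K : k₁ ∈ D.brGp b ⊓ conjSubgroup h (D.brGp b'') :=
      ⟨hk₁, ⟨k₂, hk₂, by rw [hk₁']; simp [MulAut.conj_apply]⟩⟩
    -- `aug e = augQ q · aug k₁ · (augQ q)⁻¹`
    have he' : ιQ e = q * ιQ k₁ * q⁻¹ := by rw [hk₁e]; group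
    refine ⟨aug k₁, ⟨k₁, hk₁K, rfl⟩, ?_⟩
    simp only [MulEquiv.coe_toMonoidHom, MulAut.conj_apply]
    rw [← haug e, he', map_mul, map_mul, map_inv, haug]

end Orbit

end Literature.AnabelianGeometry.SemiGraphs
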